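import Literature.AlgebraicGeometry.Shioda1982.ExceptionalQuadruplesComplete
import HarnessLib

/-!
# Shioda 1982 / Meyer–Neutsch 1981: no exceptional quadruple at the levels `91 ≤ N ≤ 103` absent from Tabelle 1 (kernel sweep)

Topic `Literature/AlgebraicGeometry/Shioda1982`; companion of `ExceptionalQuadruplesComplete.lean` (search `checkB`, soundness
`tabelleOneCompleteAt_of_chunks`, invariant form `exists_mem_reps_of_isExceptionalQuadruple`, statement `TabelleOneCompleteAt`; sources,
method and framing in its module docstring), of the sweeps `ExceptionalQuadruplesSweepSixty/…/Ninety.lean` (all `2 ≤ N ≤ 90`),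
`…SweepOneHundredTwelve.lean` (`N = 112`), `…SweepOneHundredThirtyTwo.lean` (`N = 132`) and of the other files of this series
(`ExceptionalQuadruplesSweep<lo>To<hi>.lean`, together: every level `91 ≤ N ≤ 179` that is not a row of Tabelle 1). THEOREMS only (no
definition, no named fact): the kernel search at each level `N` of this file's range that carries NO row of
[MeyerNeutsch1981Fermatquadrupel, Tabelle 1] (computer-generated there, "alle Fermatquadrupel für N ≤ 614 ermittelt", §2 p. 53; zeros of
[Shioda1982PicardFermat, table p. 727], whose non-zero entries `N ≤ 180` are exactly the 22 table levels): `completeAt_<N>` (every sorted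
pair-free primitive Hodge 4-multiset mod `N` is standard) and `not_isExceptionalQuadruple_<N>`. With the table levels
(`ExceptionalQuadruplesComplete*.lean`: the printed list is complete at each of its 22 levels `≤ 180`) the series makes Meyer–Neutsch's
classification of the exceptional surface classes kernel-certified at EVERY level `N ≤ 180`; above `180` there are none by Aoki's
Theorem C ([Aoki1983], computer-assisted for `181 ≤ m ≤ 672`, not a kernel statement). `decide +kernel` only (no `native_decide`),
chunked by first entries to bound the memory of a single kernel evaluation (≈ 0.9 ms of kernel time per candidate triple; this file
visits 346464 candidates).

HONEST FRAMING (cell `pub-hfermat`): explicit algebraic cycles for specific Hodge classes on Fermat/Delsarte varieties; residual open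
instances listed; no claim on general Hodge. These classes are algebraic (Lefschetz (1,1)); certified here is only the emptiness of the
exceptional list at these levels.

## References
* [MeyerNeutsch1981Fermatquadrupel] W. Meyer, W. Neutsch, *Fermatquadrupel*, Math. Ann. 256 (1981) 51–62, §2 p. 53, Tabelle 1 p. 54 (no rows 91, 92, 93, 94, 95, 96, 97, 98, 99, 100, 101, 102, 103).
* [Shioda1982PicardFermat] T. Shioda, J. Fac. Sci. Univ. Tokyo IA 28 (1982) 725–734, table p. 727.
* [Aoki1983] N. Aoki, Math. Ann. 266 (1983) 23–54, Thm. C.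
-/

namespace Literature.AlgebraicGeometry.Shioda1982

open Literature.AlgebraicGeometry.HodgeTheory

set_option maxHeartbeats 0 in
/-- **Tabelle 1 is complete at `N = 91`, where it is empty**: every sorted Hodge 4-multiset mod `91` without a pair and with
`gcd = 1` is standard. Kernel exhaustion (`checkB`, 1 chunk of first entries, 21975 candidate triples).
[cite: MeyerNeutsch1981Fermatquadrupel, §2 p. 53 ("alle Fermatquadrupel für N ≤ 614 ermittelt") and Tabelle 1 p. 54 (no row 91)]
[cite: Shioda1982PicardFermat, table p. 727] -/
theorem completeAt_ninetyOne : TabelleOneCompleteAt 91 :=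
  tabelleOneCompleteAt_of_chunks 91 [(0, 91)] (by decide +kernel) (by
    intro p hp
    rw [List.mem_singleton] at hp
    subst hp
    decide +kernel)

set_option maxHeartbeats 0 in
/-- **Tabelle 1 is complete at `N = 92`, where it is empty**: every sorted Hodge 4-multiset mod `92` without a pair and with
`gcd = 1` is standard. Kernel exhaustion (`checkB`, 1 chunk of first entries, 22696 candidate triples).
[cite: MeyerNeutsch1981Fermatquadrupel, §2 p. 53 ("alle Fermatquadrupel für N ≤ 614 ermittelt") and Tabelle 1 p. 54 (no row 92)]
[cite: Shioda1982PicardFermat, table p. 727] -/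
theorem completeAt_ninetyTwo : TabelleOneCompleteAt 92 :=
  tabelleOneCompleteAt_of_chunks 92 [(0, 92)] (by decide +kernel) (by
    intro p hp
    rw [List.mem_singleton] at hp
    subst hp
    decide +kernel)

set_option maxHeartbeats 0 in
/-- **Tabelle 1 is complete at `N = 93`, where it is empty**: every sorted Hodge 4-multiset mod `93` without a pair and with
`gcd = 1` is standard. Kernel exhaustion (`checkB`, 1 chunk of first entries, 23432 candidate triples).
[cite: MeyerNeutsch1981Fermatquadrupel, §2 p. 53 ("alle Fermatquadrupel für N ≤ 614 ermittelt") and Tabelle 1 p. 54 (no row 93)]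
[cite: Shioda1982PicardFermat, table p. 727] -/
theorem completeAt_ninetyThree : TabelleOneCompleteAt 93 :=
  tabelleOneCompleteAt_of_chunks 93 [(0, 93)] (by decide +kernel) (by
    intro p hp
    rw [List.mem_singleton] at hp
    subst hp
    decide +kernel)

set_option maxHeartbeats 0 in
/-- **Tabelle 1 is complete at `N = 94`, where it is empty**: every sorted Hodge 4-multiset mod `94` without a pair and with
`gcd = 1` is standard. Kernel exhaustion (`checkB`, 1 chunk of first entries, 24184 candidate triples).
[cite: MeyerNeutsch1981Fermatquadrupel, §2 p. 53 ("alle Fermatquadrupel für N ≤ 614 ermittelt") and Tabelle 1 p. 54 (no row 94)]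
[cite: Shioda1982PicardFermat, table p. 727] -/
theorem completeAt_ninetyFour : TabelleOneCompleteAt 94 :=
  tabelleOneCompleteAt_of_chunks 94 [(0, 94)] (by decide +kernel) (by
    intro p hp
    rw [List.mem_singleton] at hp
    subst hp
    decide +kernel)

set_option maxHeartbeats 0 in
/-- **Tabelle 1 is complete at `N = 95`, where it is empty**: every sorted Hodge 4-multiset mod `95` without a pair and with
`gcd = 1` is standard. Kernel exhaustion (`checkB`, 1 chunk of first entries, 24952 candidate triples).
[cite: MeyerNeutsch1981Fermatquadrupel, §2 p. 53 ("alle Fermatquadrupel für N ≤ 614 ermittelt") and Tabelle 1 p. 54 (no row 95)]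
[cite: Shioda1982PicardFermat, table p. 727] -/
theorem completeAt_ninetyFive : TabelleOneCompleteAt 95 :=
  tabelleOneCompleteAt_of_chunks 95 [(0, 95)] (by decide +kernel) (by
    intro p hp
    rw [List.mem_singleton] at hp
    subst hp
    decide +kernel)

set_option maxHeartbeats 0 in
/-- **Tabelle 1 is complete at `N = 96`, where it is empty**: every sorted Hodge 4-multiset mod `96` without a pair and with
`gcd = 1` is standard. Kernel exhaustion (`checkB`, 2 chunks of first entries, 25736 candidate triples).
[cite: MeyerNeutsch1981Fermatquadrupel, §2 p. 53 ("alle Fermatquadrupel für N ≤ 614 ermittelt") and Tabelle 1 p. 54 (no row 96)]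
[cite: Shioda1982PicardFermat, table p. 727] -/
theorem completeAt_ninetySix : TabelleOneCompleteAt 96 :=
  tabelleOneCompleteAt_of_chunks 96 [(0, 37), (37, 59)] (by decide +kernel) (by
    intro p hp
    simp only [List.mem_cons, List.not_mem_nil, or_false] at hp
    rcases hp with rfl | rfl <;> decide +kernel)

set_option maxHeartbeats 0 in
/-- **Tabelle 1 is complete at `N = 97`, where it is empty**: every sorted Hodge 4-multiset mod `97` without a pair and with
`gcd = 1` is standard. Kernel exhaustion (`checkB`, 2 chunks of first entries, 26536 candidate triples).
[cite: MeyerNeutsch1981Fermatquadrupel, §2 p. 53 ("alle Fermatquadrupel für N ≤ 614 ermittelt") and Tabelle 1 p. 54 (no row 97)]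
[cite: Shioda1982PicardFermat, table p. 727] -/
theorem completeAt_ninetySeven : TabelleOneCompleteAt 97 :=
  tabelleOneCompleteAt_of_chunks 97 [(0, 34), (34, 63)] (by decide +kernel) (by
    intro p hp
    simp only [List.mem_cons, List.not_mem_nil, or_false] at hp
    rcases hp with rfl | rfl <;> decide +kernel)

set_option maxHeartbeats 0 in
/-- **Tabelle 1 is complete at `N = 98`, where it is empty**: every sorted Hodge 4-multiset mod `98` without a pair and with
`gcd = 1` is standard. Kernel exhaustion (`checkB`, 2 chunks of first entries, 27353 candidate triples).
[cite: MeyerNeutsch1981Fermatquadrupel, §2 p. 53 ("alle Fermatquadrupel für N ≤ 614 ermittelt") and Tabelle 1 p. 54 (no row 98)]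
[cite: Shioda1982PicardFermat, table p. 727] -/
theorem completeAt_ninetyEight : TabelleOneCompleteAt 98 :=
  tabelleOneCompleteAt_of_chunks 98 [(0, 32), (32, 66)] (by decide +kernel) (by
    intro p hp
    simp only [List.mem_cons, List.not_mem_nil, or_false] at hp
    rcases hp with rfl | rfl <;> decide +kernel)

set_option maxHeartbeats 0 in
/-- **Tabelle 1 is complete at `N = 99`, where it is empty**: every sorted Hodge 4-multiset mod `99` without a pair and with
`gcd = 1` is standard. Kernel exhaustion (`checkB`, 2 chunks of first entries, 28186 candidate triples).
[cite: MeyerNeutsch1981Fermatquadrupel, §2 p. 53 ("alle Fermatquadrupel für N ≤ 614 ermittelt") and Tabelle 1 p. 54 (no row 99)]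
[cite: Shioda1982PicardFermat, table p. 727] -/
theorem completeAt_ninetyNine : TabelleOneCompleteAt 99 :=
  tabelleOneCompleteAt_of_chunks 99 [(0, 31), (31, 68)] (by decide +kernel) (by
    intro p hp
    simp only [List.mem_cons, List.not_mem_nil, or_false] at hp
    rcases hp with rfl | rfl <;> decide +kernel)

set_option maxHeartbeats 0 in
/-- **Tabelle 1 is complete at `N = 100`, where it is empty**: every sorted Hodge 4-multiset mod `100` without a pair and with
`gcd = 1` is standard. Kernel exhaustion (`checkB`, 2 chunks of first entries, 29036 candidate triples).
[cite: MeyerNeutsch1981Fermatquadrupel, §2 p. 53 ("alle Fermatquadrupel für N ≤ 614 ermittelt") and Tabelle 1 p. 54 (no row 100)]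
[cite: Shioda1982PicardFermat, table p. 727] -/
theorem completeAt_oneHundred : TabelleOneCompleteAt 100 :=
  tabelleOneCompleteAt_of_chunks 100 [(0, 30), (30, 70)] (by decide +kernel) (by
    intro p hp
    simp only [List.mem_cons, List.not_mem_nil, or_false] at hp
    rcases hp with rfl | rfl <;> decide +kernel)

set_option maxHeartbeats 0 in
/-- **Tabelle 1 is complete at `N = 101`, where it is empty**: every sorted Hodge 4-multiset mod `101` without a pair and with
`gcd = 1` is standard. Kernel exhaustion (`checkB`, 2 chunks of first entries, 29903 candidate triples).
[cite: MeyerNeutsch1981Fermatquadrupel, §2 p. 53 ("alle Fermatquadrupel für N ≤ 614 ermittelt") and Tabelle 1 p. 54 (no row 101)]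
[cite: Shioda1982PicardFermat, table p. 727] -/
theorem completeAt_oneHundredOne : TabelleOneCompleteAt 101 :=
  tabelleOneCompleteAt_of_chunks 101 [(0, 29), (29, 72)] (by decide +kernel) (by
    intro p hp
    simp only [List.mem_cons, List.not_mem_nil, or_false] at hp
    rcases hp with rfl | rfl <;> decide +kernel)

set_option maxHeartbeats 0 in
/-- **Tabelle 1 is complete at `N = 102`, where it is empty**: every sorted Hodge 4-multiset mod `102` without a pair and with
`gcd = 1` is standard. Kernel exhaustion (`checkB`, 2 chunks of first entries, 30787 candidate triples).
[cite: MeyerNeutsch1981Fermatquadrupel, §2 p. 53 ("alle Fermatquadrupel für N ≤ 614 ermittelt") and Tabelle 1 p. 54 (no row 102)]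
[cite: Shioda1982PicardFermat, table p. 727] -/
theorem completeAt_oneHundredTwo : TabelleOneCompleteAt 102 :=
  tabelleOneCompleteAt_of_chunks 102 [(0, 28), (28, 74)] (by decide +kernel) (by
    intro p hp
    simp only [List.mem_cons, List.not_mem_nil, or_false] at hp
    rcases hp with rfl | rfl <;> decide +kernel)

set_option maxHeartbeats 0 in
/-- **Tabelle 1 is complete at `N = 103`, where it is empty**: every sorted Hodge 4-multiset mod `103` without a pair and with
`gcd = 1` is standard. Kernel exhaustion (`checkB`, 2 chunks of first entries, 31688 candidate triples).
[cite: MeyerNeutsch1981Fermatquadrupel, §2 p. 53 ("alle Fermatquadrupel für N ≤ 614 ermittelt") and Tabelle 1 p. 54 (no row 103)]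
[cite: Shioda1982PicardFermat, table p. 727] -/
theorem completeAt_oneHundredThree : TabelleOneCompleteAt 103 :=
  tabelleOneCompleteAt_of_chunks 103 [(0, 27), (27, 76)] (by decide +kernel) (by
    intro p hp
    simp only [List.mem_cons, List.not_mem_nil, or_false] at hp
    rcases hp with rfl | rfl <;> decide +kernel)

/-- **No exceptional quadruple ("Ausnahmequadrupel") at the level `91`** (`tabelleOne 91 = []`).
[cite: MeyerNeutsch1981Fermatquadrupel, Tabelle 1 p. 54 (no row 91)] [cite: Shioda1982PicardFermat, table p. 727] -/
theorem not_isExceptionalQuadruple_ninetyOne (s : Multiset (ZMod 91)) : ¬ IsExceptionalQuadruple 91 s := by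
  intro hs
  obtain ⟨r, hr, -⟩ := exists_mem_reps_of_isExceptionalQuadruple completeAt_ninetyOne hs
  simp [reps, tabelleOne] at hr

/-- **No exceptional quadruple ("Ausnahmequadrupel") at the level `92`** (`tabelleOne 92 = []`).
[cite: MeyerNeutsch1981Fermatquadrupel, Tabelle 1 p. 54 (no row 92)] [cite: Shioda1982PicardFermat, table p. 727] -/
theorem not_isExceptionalQuadruple_ninetyTwo (s : Multiset (ZMod 92)) : ¬ IsExceptionalQuadruple 92 s := by
  intro hs
  obtain ⟨r, hr, -⟩ := exists_mem_reps_of_isExceptionalQuadruple completeAt_ninetyTwo hs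
  simp [reps, tabelleOne] at hr

/-- **No exceptional quadruple ("Ausnahmequadrupel") at the level `93`** (`tabelleOne 93 = []`).
[cite: MeyerNeutsch1981Fermatquadrupel, Tabelle 1 p. 54 (no row 93)] [cite: Shioda1982PicardFermat, table p. 727] -/
theorem not_isExceptionalQuadruple_ninetyThree (s : Multiset (ZMod 93)) : ¬ IsExceptionalQuadruple 93 s := by
  intro hs
  obtain ⟨r, hr, -⟩ := exists_mem_reps_of_isExceptionalQuadruple completeAt_ninetyThree hs
  simp [reps, tabelleOne] at hr

/-- **No exceptional quadruple ("Ausnahmequadrupel") at the level `94`** (`tabelleOne 94 = []`).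
[cite: MeyerNeutsch1981Fermatquadrupel, Tabelle 1 p. 54 (no row 94)] [cite: Shioda1982PicardFermat, table p. 727] -/
theorem not_isExceptionalQuadruple_ninetyFour (s : Multiset (ZMod 94)) : ¬ IsExceptionalQuadruple 94 s := by
  intro hs
  obtain ⟨r, hr, -⟩ := exists_mem_reps_of_isExceptionalQuadruple completeAt_ninetyFour hs
  simp [reps, tabelleOne] at hr

/-- **No exceptional quadruple ("Ausnahmequadrupel") at the level `95`** (`tabelleOne 95 = []`).
[cite: MeyerNeutsch1981Fermatquadrupel, Tabelle 1 p. 54 (no row 95)] [cite: Shioda1982PicardFermat, table p. 727] -/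
theorem not_isExceptionalQuadruple_ninetyFive (s : Multiset (ZMod 95)) : ¬ IsExceptionalQuadruple 95 s := by
  intro hs
  obtain ⟨r, hr, -⟩ := exists_mem_reps_of_isExceptionalQuadruple completeAt_ninetyFive hs
  simp [reps, tabelleOne] at hr

/-- **No exceptional quadruple ("Ausnahmequadrupel") at the level `96`** (`tabelleOne 96 = []`).
[cite: MeyerNeutsch1981Fermatquadrupel, Tabelle 1 p. 54 (no row 96)] [cite: Shioda1982PicardFermat, table p. 727] -/
theorem not_isExceptionalQuadruple_ninetySix (s : Multiset (ZMod 96)) : ¬ IsExceptionalQuadruple 96 s := by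
  intro hs
  obtain ⟨r, hr, -⟩ := exists_mem_reps_of_isExceptionalQuadruple completeAt_ninetySix hs
  simp [reps, tabelleOne] at hr

/-- **No exceptional quadruple ("Ausnahmequadrupel") at the level `97`** (`tabelleOne 97 = []`).
[cite: MeyerNeutsch1981Fermatquadrupel, Tabelle 1 p. 54 (no row 97)] [cite: Shioda1982PicardFermat, table p. 727] -/
theorem not_isExceptionalQuadruple_ninetySeven (s : Multiset (ZMod 97)) : ¬ IsExceptionalQuadruple 97 s := by
  intro hs
  obtain ⟨r, hr, -⟩ := exists_mem_reps_of_isExceptionalQuadruple completeAt_ninetySeven hs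
  simp [reps, tabelleOne] at hr

/-- **No exceptional quadruple ("Ausnahmequadrupel") at the level `98`** (`tabelleOne 98 = []`).
[cite: MeyerNeutsch1981Fermatquadrupel, Tabelle 1 p. 54 (no row 98)] [cite: Shioda1982PicardFermat, table p. 727] -/
theorem not_isExceptionalQuadruple_ninetyEight (s : Multiset (ZMod 98)) : ¬ IsExceptionalQuadruple 98 s := by
  intro hs
  obtain ⟨r, hr, -⟩ := exists_mem_reps_of_isExceptionalQuadruple completeAt_ninetyEight hs
  simp [reps, tabelleOne] at hr

/-- **No exceptional quadruple ("Ausnahmequadrupel") at the level `99`** (`tabelleOne 99 = []`).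
[cite: MeyerNeutsch1981Fermatquadrupel, Tabelle 1 p. 54 (no row 99)] [cite: Shioda1982PicardFermat, table p. 727] -/
theorem not_isExceptionalQuadruple_ninetyNine (s : Multiset (ZMod 99)) : ¬ IsExceptionalQuadruple 99 s := by
  intro hs
  obtain ⟨r, hr, -⟩ := exists_mem_reps_of_isExceptionalQuadruple completeAt_ninetyNine hs
  simp [reps, tabelleOne] at hr

/-- **No exceptional quadruple ("Ausnahmequadrupel") at the level `100`** (`tabelleOne 100 = []`).
[cite: MeyerNeutsch1981Fermatquadrupel, Tabelle 1 p. 54 (no row 100)] [cite: Shioda1982PicardFermat, table p. 727] -/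
theorem not_isExceptionalQuadruple_oneHundred (s : Multiset (ZMod 100)) : ¬ IsExceptionalQuadruple 100 s := by
  intro hs
  obtain ⟨r, hr, -⟩ := exists_mem_reps_of_isExceptionalQuadruple completeAt_oneHundred hs
  simp [reps, tabelleOne] at hr

/-- **No exceptional quadruple ("Ausnahmequadrupel") at the level `101`** (`tabelleOne 101 = []`).
[cite: MeyerNeutsch1981Fermatquadrupel, Tabelle 1 p. 54 (no row 101)] [cite: Shioda1982PicardFermat, table p. 727] -/
theorem not_isExceptionalQuadruple_oneHundredOne (s : Multiset (ZMod 101)) : ¬ IsExceptionalQuadruple 101 s := by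
  intro hs
  obtain ⟨r, hr, -⟩ := exists_mem_reps_of_isExceptionalQuadruple completeAt_oneHundredOne hs
  simp [reps, tabelleOne] at hr

/-- **No exceptional quadruple ("Ausnahmequadrupel") at the level `102`** (`tabelleOne 102 = []`).
[cite: MeyerNeutsch1981Fermatquadrupel, Tabelle 1 p. 54 (no row 102)] [cite: Shioda1982PicardFermat, table p. 727] -/
theorem not_isExceptionalQuadruple_oneHundredTwo (s : Multiset (ZMod 102)) : ¬ IsExceptionalQuadruple 102 s := by
  intro hs
  obtain ⟨r, hr, -⟩ := exists_mem_reps_of_isExceptionalQuadruple completeAt_oneHundredTwo hs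
  simp [reps, tabelleOne] at hr

/-- **No exceptional quadruple ("Ausnahmequadrupel") at the level `103`** (`tabelleOne 103 = []`).
[cite: MeyerNeutsch1981Fermatquadrupel, Tabelle 1 p. 54 (no row 103)] [cite: Shioda1982PicardFermat, table p. 727] -/
theorem not_isExceptionalQuadruple_oneHundredThree (s : Multiset (ZMod 103)) : ¬ IsExceptionalQuadruple 103 s := by
  intro hs
  obtain ⟨r, hr, -⟩ := exists_mem_reps_of_isExceptionalQuadruple completeAt_oneHundredThree hs
  simp [reps, tabelleOne] at hr

end Literature.AlgebraicGeometry.Shioda1982
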